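import Summits.BirchSwinnertonDyer.Rank1Residual.GaloisImage.KolyvaginSystemsCoreRankZero
import HarnessLib

/-!
# Route `KimAtThreeKolyvagin` (rung W2), crux `DeepUpperAtThree`: transport of VANISHING of a
# Kolyvagin system along an edge of the core graph `𝒳⁰` at a GENERAL MODULUS — the second kernel
# piece of the STUB port beyond `m = 1`

Cell `bsd-addord`, seat `bsd-addord-w2-c3` (D-0074 row B6), item `stmt-BirchSwinnertonDyer-19076`.
TOOL theorem on Kolyvagin systems of a finite discrete `Γ_K`-module killed by ANY `n`; no definition,
no named fact, no `sorry`; nothing asserted about any curve.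

WHY.  The STUB port `hStub` of `KimAtThreeDeepUpperOfPortsDevissage.deepUpper_conclusion_of_ports_of_towerSurj`
is Mazur–Rubin's Thm. 4.4.1 (`Γ(𝓗′) = Γ(𝓗)`) at the empty level; its proof in the case `χ(T) = 1`
(Mem. AMS 799 p. 46, held: HOME/lit/mazurrubin2004 p0052) runs: Howard's section `κ′ ∈ Γ(𝓗′)` with
`κ′_m = κ_m` at a core vertex `m`; `κ̄ = κ − κ′` vanishes at `m`, HENCE ON EVERY VERTEX OF `𝒳⁰`
("`𝒳⁰` is connected and `𝓗⁰` is locally free of rank one … Proposition 3.4.4 (i)") — i.e. along every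
edge `(n, nℓ)` of `𝒳⁰` (both vertex-to-edge maps isomorphisms) `κ̄_{nℓ} = 0 ↔ κ̄_n = 0`; then an
induction off the core vertices.  The tree has this edge transport at `m = 1` only
(`CoreRankOne.apply_insert_eq_zero_iff_of_edge`, n1011 `KolyvaginCoreTransport` §7, where "loc_𝔮 non-zero
on the LINE `H(n)`" is injectivity because `#H(n) = p`).  This file proves it at ANY modulus with the
edge condition in its general form — `loc_𝔮` injective on `H¹_{𝓕(n)}` and on `H¹_{𝓕(n𝔮)}` — and the
local shape `H¹_ur ∩ 𝒯_𝔮 = 0`: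
* `StubStep.apply_insert_eq_zero_iff_of_loc_injective` — `κ_{n𝔮} = 0 ↔ κ_n = 0` (→: the
  finite–singular relation and admissibility, n1011's modulus-generic
  `CoreRankZero.apply_insert_ne_zero_of_localization_ne_zero`; ←: `v_𝔮(κ_{n𝔮}) = φ^{fs}_𝔮(0) = 0`, so
  `loc_𝔮 κ_{n𝔮} ∈ H¹_ur ∩ 𝒯_𝔮 = 0`).
[cite: MazurRubin2004, Prop. 3.4.4 (i), Def. 4.3.6, Lemma 4.3.7 and Thm. 4.4.1 (proof, p. 46)]
[cite: Rubin2011, Def. 2.8.6 and Prop. 2.3.2 (pp. 19, 25)] [cite: Sakamoto2024, §6 (p. 930)]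
-/

set_option autoImplicit false
-- the Theorems namespace of a single-conjunct summit repeats the summit name by design (D-0017)
set_option linter.dupNamespace false

noncomputable section

open scoped Classical NumberField ContRepresentation
open Function NumberField IsDedekindDomain
  Literature.NumberTheory.GaloisRepresentations
  Literature.NumberTheory.GaloisRepresentations.DiscreteGaloisModule Literature.NumberTheory.GaloisCohomology
  Summit.BirchSwinnertonDyer.Rank1Residual.GaloisImage
  Summit.BirchSwinnertonDyer.Rank1Residual.GaloisImage.CoreRankZero

universe u

namespace Summit.BirchSwinnertonDyer.BirchSwinnertonDyer.Theorems.KimAtThreeDeepUpperStubEdge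

namespace StubStep

variable {K : Type u} [Field K] [NumberField K]
variable {M : Type u} [AddCommGroup M] [TopologicalSpace M] [DiscreteTopology M]
variable {ρ : DiscreteGaloisModule K M}

/-- **Vanishing is transported along an edge of `𝒳⁰`, at any modulus.**  `𝓕` unramified outside `S`,
a Kolyvagin datum with primes off `S` and admissible comparison maps, `κ` a Kolyvagin system, a level
`n` and a prime `𝔮 ∈ 𝒫 ∖ n` with the local shape `H¹_ur(K_𝔮, M) ∩ 𝒯_𝔮 = 0`; if `loc_𝔮` is INJECTIVE on
`H¹_{𝓕(n)}(K, M)` and on `H¹_{𝓕(n𝔮)}(K, M)` (the edge condition of `𝒳⁰` in its general-modulus form),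
then `κ_{n𝔮} = 0 ↔ κ_n = 0`. [cite: MazurRubin2004, Prop. 3.4.4 (i) and Lemma 4.3.7]
[cite: Rubin2011, Prop. 2.3.2 (p. 19) and Def. 2.8.6 (p. 25)] -/
theorem apply_insert_eq_zero_iff_of_loc_injective {S : Finset (Place K)} {𝓕 : SelmerStructure ρ}
    (h𝓕 : 𝓕.IsUnramifiedOutside S) {D : KolyvaginDatum ρ}
    (hPS : ∀ q ∈ D.primes, (Sum.inr q : Place K) ∉ S) (hadm : D.IsAdmissible)
    {κ : Finset (HeightOneSpectrum (𝓞 K)) → galoisCohomology ρ 1} (hκ : D.IsKolyvaginSystem 𝓕 κ)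
    {n : Finset (HeightOneSpectrum (𝓞 K))} (hn : D.IsLevel n)
    {q : HeightOneSpectrum (𝓞 K)} (hq : q ∈ D.primes) (hqn : q ∉ n)
    (hUT0 : unramifiedSubgroup (GaloisRep.toLocal q ρ) 1 ⊓ D.transverse (Sum.inr q) = ⊥)
    (hinjn : ∀ x ∈ (D.atLevel 𝓕 n).selmerGroup,
      galoisCohomology.localization ρ (Sum.inr q) 1 x = 0 → x = 0)
    (hinjnq : ∀ x ∈ (D.atLevel 𝓕 (insert q n)).selmerGroup,
      galoisCohomology.localization ρ (Sum.inr q) 1 x = 0 → x = 0) :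
    κ (insert q n) = 0 ↔ κ n = 0 := by
  have hκn := hκ.mem_selmerGroup n hn
  have hκnq := hκ.mem_selmerGroup _ (hn.insert hq)
  constructor
  · -- `κ_{n𝔮} = 0 ⟹ loc_𝔮 κ_n = 0` (finite–singular relation, admissibility) `⟹ κ_n = 0`
    intro h0
    by_contra hne
    have hloc : galoisCohomology.localization ρ (Sum.inr q) 1 (κ n) ≠ 0 :=
      fun h => hne (hinjn _ hκn h)
    exact apply_insert_ne_zero_of_localization_ne_zero h𝓕 hPS hadm hκ hn hq hqn hloc
      (by rw [h0, map_zero])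
  · -- `κ_n = 0 ⟹ v_𝔮(κ_{n𝔮}) = 0 ⟹ loc_𝔮 κ_{n𝔮} ∈ H¹_ur ∩ 𝒯_𝔮 = 0 ⟹ κ_{n𝔮} = 0`
    intro h0
    have hrel := hκ.fs_rel n hn q hq hqn
    have hL : KolyvaginDatum.singularLocalization ρ q (κ (insert q n)) =
        singularMap (GaloisRep.toLocal q ρ)
          (galoisCohomology.localization ρ (Sum.inr q) 1 (κ (insert q n))) := rfl
    rw [hL, h0, map_zero, singularMap_eq_zero_iff] at hrel
    have hmemT : galoisCohomology.localization ρ (Sum.inr q) 1 (κ (insert q n)) ∈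
        D.transverse (Sum.inr q) := by
      have h := (SelmerStructure.mem_selmerGroup_iff _ _).1 hκnq (Sum.inr q)
      rwa [Level.atLevel_insert_inr_self] at h
    have hmem : (galoisCohomology.localization ρ (Sum.inr q) 1 (κ (insert q n)) :
        galoisCohomology (GaloisRep.toLocal q ρ) 1) ∈
          unramifiedSubgroup (GaloisRep.toLocal q ρ) 1 ⊓ D.transverse (Sum.inr q) :=
      AddSubgroup.mem_inf.2 ⟨hrel, hmemT⟩
    rw [hUT0] at hmem
    exact hinjnq _ hκnq ((AddSubgroup.mem_bot (G := galoisCohomology (GaloisRep.toLocal q ρ) 1)).1 hmem)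

/-- **Along a path of such edges, vanishing at the start propagates to the end** (finite induction on
the added primes, the `𝒳⁰`-path form used in the proof of Mazur–Rubin Thm. 4.4.1, Case `χ(T) = 1`):
if `κ_n = 0` and the primes `q₁, …, q_r ∉ n` of `𝒫` are added one at a time with the edge condition at
each step, then `κ_{n q₁ ⋯ q_r} = 0`. [cite: MazurRubin2004, Prop. 3.4.4 (i) and Thm. 4.4.1 (proof, p. 46)] -/
theorem apply_eq_zero_of_path {S : Finset (Place K)} {𝓕 : SelmerStructure ρ}
    (h𝓕 : 𝓕.IsUnramifiedOutside S) {D : KolyvaginDatum ρ}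
    (hPS : ∀ q ∈ D.primes, (Sum.inr q : Place K) ∉ S) (hadm : D.IsAdmissible)
    (hUT0 : ∀ q ∈ D.primes, unramifiedSubgroup (GaloisRep.toLocal q ρ) 1 ⊓ D.transverse (Sum.inr q) = ⊥)
    {κ : Finset (HeightOneSpectrum (𝓞 K)) → galoisCohomology ρ 1} (hκ : D.IsKolyvaginSystem 𝓕 κ)
    (path : List (HeightOneSpectrum (𝓞 K))) :
    ∀ {n : Finset (HeightOneSpectrum (𝓞 K))}, D.IsLevel n → path.Nodup → (∀ q ∈ path, q ∈ D.primes ∧ q ∉ n) →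
      (∀ (m : Finset (HeightOneSpectrum (𝓞 K))) (q : HeightOneSpectrum (𝓞 K)), n ⊆ m → q ∈ path →
        q ∉ m → D.IsLevel m →
        (∀ x ∈ (D.atLevel 𝓕 m).selmerGroup,
          galoisCohomology.localization ρ (Sum.inr q) 1 x = 0 → x = 0) ∧
        (∀ x ∈ (D.atLevel 𝓕 (insert q m)).selmerGroup,
          galoisCohomology.localization ρ (Sum.inr q) 1 x = 0 → x = 0)) →
      κ n = 0 → κ (n ∪ path.toFinset) = 0 := by
  induction path with
  | nil =>
    intro n _ _ _ _ h0
    simpa using h0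
  | cons q rest ih =>
    intro n hn hnodup hmem hedge h0
    have hq : q ∈ D.primes ∧ q ∉ n := hmem q (by simp)
    have hqrest : q ∉ rest := (List.nodup_cons.1 hnodup).1
    -- first edge: `n → n q`
    have hstep := (apply_insert_eq_zero_iff_of_loc_injective h𝓕 hPS hadm hκ hn hq.1 hq.2 (hUT0 q hq.1)
      (hedge n q subset_rfl (by simp) hq.2 hn).1 (hedge n q subset_rfl (by simp) hq.2 hn).2).2 h0
    -- then the rest of the path from `n q`
    have hn' : D.IsLevel (insert q n) := hn.insert hq.1
    have h := ih hn' (List.nodup_cons.1 hnodup).2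
      (fun r hr => ⟨(hmem r (List.mem_cons_of_mem q hr)).1, fun h => by
        rcases Finset.mem_insert.1 h with h | h
        · exact hqrest (h ▸ hr)
        · exact (hmem r (List.mem_cons_of_mem q hr)).2 h⟩)
      (fun m r hm hr hrm hlev => hedge m r ((Finset.subset_insert q n).trans hm)
        (List.mem_cons_of_mem q hr) hrm hlev) hstep
    have heq : n ∪ (q :: rest).toFinset = insert q n ∪ rest.toFinset := by
      ext x
      simp only [Finset.mem_union, List.toFinset_cons, Finset.mem_insert, List.mem_toFinset]
      tauto
    rw [heq]
    exact h

end StubStep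

end Summit.BirchSwinnertonDyer.BirchSwinnertonDyer.Theorems.KimAtThreeDeepUpperStubEdge

end
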